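import Literature.Topology.FourManifolds.StraightLineIsotopyExtensionSupport
import Literature.Topology.FourManifolds.DiffeotopyTransport
import HarnessLib

/-!
# Isotopy extension for straight-line isotopies near a compact set: the whole diffeotopy

Topic `Literature/Topology/FourManifolds`; a complement to `StraightLineIsotopyExtension.lean`
and `StraightLineIsotopyExtensionSupport.lean` (Hirsch, *Differential Topology* (1976), Ch. 8
§1, Thms. 1.3–1.4 for the straight-line isotopies `h_t = id + t (P - id)` of the uniqueness of
tubular neighbourhoods; Kosinski, *Differential Manifolds* (1993), II (5.2), III (3.5)).  Those
files return the end `Φ = Φ₁` of the diffeotopy generated by the cut-off velocity field of the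
track; here **the whole one-parameter family is returned, as a `Diffeotopy` of `E`**
(`Diffeotopy.lean`: the track `(s, y) ↦ (s, Φ_s y)` is a diffeomorphism of `ℝ × E`):

* `exists_diffeotopy_eqOn_nhdsSet_of_straightLine_of_subset` — under the hypotheses of
  `exists_diffeomorph_eqOn_nhdsSet_of_straightLine_of_subset` (`Z` compact, `P` smooth on an
  open `W ⊇ Z` with `P = id` on `Z` and `id + t (DP - id)` injective along `Z` for `0 ≤ t ≤ 1`,
  `W' ⊇ Z` open) there is a diffeotopy `Φ` of `E` with `Φ₀ = id`, **`Φ₁ = P` on a neighbourhood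
  of `Z`**, **`Φ_s = id` and `Φ_s⁻¹ = id` off `W'` for every `s`**, and `Φ_s = id` off a ball
  for every `s` — Hirsch's Thm. 1.3 as printed: *"`F` extends to a diffeotopy of `M` having
  compact support in `U`"*.

The proof is that of `StraightLineIsotopyExtensionSupport.lean` verbatim up to its last step,
where the time-dependent flow `Literature.Analysis.ODE.tdFlow` (`CompactSupportFlow.lean`: jointly
smooth in `(t₀, t, x)`, Chapman–Kolmogorov law `tdFlow_trans`, `tdFlow_self`) from time `0` to
time `s` and back is packaged by `Diffeotopy.mk'`.  This is the form in which the uniqueness of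
tubular neighbourhoods of a circle in a 3-manifold is used by the isotopy invariance of 2-handle
attachment (`Geometry/Symplectic/TwoHandleIsotopy.lean`): the diffeotopy, transported into the
boundary 3-manifold `∂W` through a tube chart, is spread over a collar of `∂W`.  Everything here
is proved; no definition and no named fact is introduced.

## References

* M. W. Hirsch, *Differential Topology*, GTM 33, Springer (1976), Ch. 8 §1, Thms. 1.1–1.4.
  [Hirsch1976]
* A. Kosinski, *Differential Manifolds*, Academic Press (1993), Ch. II, Thm. (5.2); Ch. III,
  Thm. (3.5). [Kosinski1993]
-/

noncomputable section

open Set Metric Filter Topology Function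
open scoped ContDiff NNReal Manifold

namespace Literature.Topology.FourManifolds

universe u

section Extension

variable {E : Type u} [NormedAddCommGroup E] [NormedSpace ℝ E] [FiniteDimensional ℝ E]

/-- **Isotopy extension for straight-line isotopies near a compact set, the whole diffeotopy,
with support in a prescribed neighbourhood** (Hirsch, *Differential Topology* (1976), Ch. 8 §1,
Thms. 1.3–1.4: *"`F` extends to a diffeotopy of `M` having compact support in `U`"*; Kosinski
(1993), II.(5.2)).  Let `Z` be a compact subset of a finite-dimensional real normed space `E`,
`P` a `C^∞` map on an open `W ⊇ Z` with `P z = z` on `Z`, with derivative `D z` at the points of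
`Z`, such that `id + t (D z - id)` is injective for all `z ∈ Z`, `t ∈ [0, 1]`, and let `W'` be
any open set containing `Z`.  Then there is a diffeotopy `Φ` of `E` (`Φ₀ = id`) with `Φ₁ = P` on
a neighbourhood of `Z`, `Φ_s = id = Φ_s⁻¹` off `W'` for all `s`, and `Φ_s = id` off a ball for
all `s`. [cite: Hirsch1976, Ch. 8 §1, Thm. 1.3] -/
theorem exists_diffeotopy_eqOn_nhdsSet_of_straightLine_of_subset {Z W : Set E}
    (hZ : IsCompact Z) (hW : IsOpen W) (hZW : Z ⊆ W) {P : E → E} (hP : ContDiffOn ℝ ∞ P W)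
    (hPZ : ∀ z ∈ Z, P z = z) {D : E → E →L[ℝ] E} (hD : ∀ z ∈ Z, HasFDerivAt P (D z) z)
    (hinj : ∀ z ∈ Z, ∀ t ∈ Icc (0 : ℝ) 1, Injective (slDeriv t (D z)))
    {W' : Set E} (hW' : IsOpen W') (hZW' : Z ⊆ W') :
    ∃ Φ : Diffeotopy 𝓘(ℝ, E) E, (∀ᶠ y in 𝓝ˢ Z, Φ.toFun 1 y = P y) ∧
      (∀ s y, y ∉ W' → Φ.toFun s y = y) ∧ (∀ s y, y ∉ W' → Φ.invFun s y = y) ∧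
      ∃ R : ℝ, ∀ s (y : E), R ≤ ‖y‖ → Φ.toFun s y = y := by
  have hPdiff : ∀ y ∈ W, HasFDerivAt P (fderiv ℝ P y) y := fun y hy =>
    ((hP.contDiffAt (hW.mem_nhds hy)).differentiableAt (by simp)).hasFDerivAt
  have hDeq : ∀ z ∈ Z, fderiv ℝ P z = D z := fun z hz => (hD z hz).fderiv
  -- Step 1: the set `S` of `(t, y)`, `y ∈ W`, where `id + t (DP(y) - id)` is invertible is open
  set A : ℝ × E → E →L[ℝ] E := fun q => slDeriv q.1 (fderiv ℝ P q.2) with hA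
  have hAcont : ContinuousOn A ((univ : Set ℝ) ×ˢ W) := by
    have hf : ContinuousOn (fun q : ℝ × E => fderiv ℝ P q.2) ((univ : Set ℝ) ×ˢ W) :=
      (hP.continuousOn_fderiv_of_isOpen hW (by simp)).comp continuousOn_snd fun q hq => hq.2
    simp only [hA, slDeriv]
    exact continuousOn_const.add (continuousOn_fst.smul (hf.sub continuousOn_const))
  set S : Set (ℝ × E) := ((univ : Set ℝ) ×ˢ W) ∩ A ⁻¹' {u | IsUnit u} with hS
  have hSopen : IsOpen S := hAcont.isOpen_inter_preimage (isOpen_univ.prod hW) Units.isOpen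
  -- the equivalences `T q` and the derivative of the track on `S`
  have hequiv : ∀ q ∈ S, ∃ T : (ℝ × E) ≃L[ℝ] ℝ × E,
      HasFDerivAt (slTrack P) (T : ℝ × E →L[ℝ] ℝ × E) q := by
    rintro ⟨t, y⟩ ⟨⟨-, hyW⟩, hunit⟩
    have hunit' : IsUnit (slDeriv t (fderiv ℝ P y)) := hunit
    set L : E ≃L[ℝ] E := ContinuousLinearEquiv.unitsEquiv ℝ E hunit'.unit with hL
    have hLcoe : (L : E →L[ℝ] E) = slDeriv t (fderiv ℝ P y) := by
      rw [hL]; ext η; simp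
    refine ⟨slTrackEquiv L (P y - y), ?_⟩
    rw [coe_slTrackEquiv L hLcoe]
    exact hasFDerivAt_slTrack (hPdiff y hyW)
  have hKS : Icc (0 : ℝ) 1 ×ˢ Z ⊆ S := by
    rintro ⟨t, z⟩ ⟨ht, hz⟩
    refine ⟨⟨mem_univ _, hZW hz⟩, ?_⟩
    show IsUnit (slDeriv t (fderiv ℝ P z))
    rw [hDeq z hz]
    obtain ⟨L, hL⟩ := exists_equiv_slDeriv (hinj z hz t ht)
    exact ⟨ContinuousLinearEquiv.toUnit L, by rw [← hL]; rfl⟩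
  -- Step 2: injectivity of the track near `[0, 1] × Z`
  have hK : IsCompact (Icc (0 : ℝ) 1 ×ˢ Z) := isCompact_Icc.prod hZ
  have htrack_cont : ContinuousOn (slTrack P) ((univ : Set ℝ) ×ˢ W) :=
    (contDiffOn_slTrack hP).continuousOn
  have htrack_at : ∀ q ∈ S, ContDiffAt ℝ ∞ (slTrack P) q := fun q hq =>
    (contDiffOn_slTrack hP).contDiffAt ((isOpen_univ.prod hW).mem_nhds hq.1)
  obtain ⟨V, hVopen, hKV, hVinj⟩ : ∃ V : Set (ℝ × E), IsOpen V ∧ Icc (0 : ℝ) 1 ×ˢ Z ⊆ V ∧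
      InjOn (slTrack P) V := by
    refine exists_isOpen_injOn_of_isCompact hK (fun q hq => ?_) (fun q hq q' hq' h => ?_)
      (fun q hq => ?_)
    · exact (htrack_at q (hKS hq)).continuousAt
    · obtain ⟨t, z⟩ := q
      obtain ⟨t', z'⟩ := q'
      rw [slTrack_of_eq P (hPZ z hq.2), slTrack_of_eq P (hPZ z' hq'.2)] at h
      exact h
    · obtain ⟨T, hT⟩ := hequiv q (hKS hq)
      have hstrict : HasStrictFDerivAt (slTrack P) (T : ℝ × E →L[ℝ] ℝ × E) q := by
        have h1 := (htrack_at q (hKS hq)).hasStrictFDerivAt (by simp)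
        rwa [hT.fderiv] at h1
      exact ⟨_, (hstrict.toOpenPartialHomeomorph _).open_source.mem_nhds
        hstrict.mem_toOpenPartialHomeomorph_source,
        (hstrict.toOpenPartialHomeomorph _).injOn⟩
  -- **the pairs `(t, y)` whose straight-line image `h_t(y)` lies in `W'`** (open, contains
  -- `[0, 1] × Z` because `h_t = id` on `Z`)
  set G : Set (ℝ × E) :=
    ((univ : Set ℝ) ×ˢ W) ∩ (fun q : ℝ × E => slIsotopy P q.1 q.2) ⁻¹' W' with hG
  have hGopen : IsOpen G := by
    have hcont : ContinuousOn (fun q : ℝ × E => slIsotopy P q.1 q.2) ((univ : Set ℝ) ×ˢ W) :=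
      htrack_cont.snd
    exact hcont.isOpen_inter_preimage (isOpen_univ.prod hW) hW'
  have hKG : Icc (0 : ℝ) 1 ×ˢ Z ⊆ G := by
    rintro ⟨t, z⟩ ⟨-, hz⟩
    refine ⟨⟨mem_univ _, hZW hz⟩, ?_⟩
    show slIsotopy P t z ∈ W'
    rw [slIsotopy_of_eq P (hPZ z hz)]
    exact hZW' hz
  -- Step 3: a product neighbourhood `J × U` of `[0, 1] × Z` inside `S ∩ V ∩ G`
  obtain ⟨J₀, U₀, hJ₀, hU₀, hIJ₀, hZU₀, hJU₀⟩ :=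
    generalized_tube_lemma isCompact_Icc hZ ((hSopen.inter hVopen).inter hGopen)
      (subset_inter (subset_inter hKS hKV) hKG)
  obtain ⟨δ, hδ, hδJ⟩ := isCompact_Icc.exists_thickening_subset_open hJ₀ hIJ₀
  set J : Set ℝ := Ioo (-δ) (1 + δ) with hJ
  have hJsub : J ⊆ J₀ := by
    intro s hs
    apply hδJ
    rw [mem_thickening_iff]
    rcases le_or_gt s 0 with h0 | h0
    · refine ⟨0, left_mem_Icc.2 zero_le_one, ?_⟩
      rw [dist_comm, Real.dist_eq, zero_sub, abs_neg, abs_of_nonpos h0]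
      linarith [hs.1]
    rcases le_or_gt s 1 with h1 | h1
    · exact ⟨s, ⟨h0.le, h1⟩, by rw [dist_self]; exact hδ⟩
    · refine ⟨1, right_mem_Icc.2 zero_le_one, ?_⟩
      rw [Real.dist_eq, abs_of_pos (by linarith)]
      linarith [hs.2]
  obtain ⟨R₀, hR₀⟩ := hZ.isBounded.subset_ball 0
  set U : Set E := U₀ ∩ ball 0 R₀ with hU
  have hUopen : IsOpen U := hU₀.inter isOpen_ball
  have hZU : Z ⊆ U := subset_inter hZU₀ hR₀
  set O : Set (ℝ × E) := J ×ˢ U with hO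
  have hOopen : IsOpen O := isOpen_Ioo.prod hUopen
  have hOS : O ⊆ S := fun q hq => (hJU₀ ⟨hJsub hq.1, hq.2.1⟩).1.1
  have hOV : O ⊆ V := fun q hq => (hJU₀ ⟨hJsub hq.1, hq.2.1⟩).1.2
  have hOW' : ∀ q ∈ O, slIsotopy P q.1 q.2 ∈ W' := fun q hq => (hJU₀ ⟨hJsub hq.1, hq.2.1⟩).2.2
  have h0J : (0 : ℝ) ∈ J := ⟨by linarith, by linarith⟩
  have hUW : U ⊆ W := fun y hy => by
    have : ((0 : ℝ), y) ∈ S := hOS ⟨h0J, hy⟩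
    exact this.1.2
  -- Step 4: the track as a partial diffeomorphism `e : O ≅ Ω`
  have hOinj : InjOn (slTrack P) O := hVinj.mono hOV
  set e₀ : PartialEquiv (ℝ × E) (ℝ × E) := hOinj.toPartialEquiv (slTrack P) O with he₀
  have hopenmap : IsOpenMap (O.restrict (slTrack P)) := by
    rw [isOpenMap_iff_nhds_le]
    rintro ⟨q, hq⟩
    obtain ⟨T, hT⟩ := hequiv q (hOS hq)
    have hstrict : HasStrictFDerivAt (slTrack P) (T : ℝ × E →L[ℝ] ℝ × E) q := by
      have h1 := (htrack_at q (hOS hq)).hasStrictFDerivAt (by simp)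
      rwa [hT.fderiv] at h1
    have hmap : map (O.restrict (slTrack P)) (𝓝 ⟨q, hq⟩) = map (slTrack P) (𝓝 q) := by
      rw [restrict_eq, ← Filter.map_map, map_nhds_subtype_val, hOopen.nhdsWithin_eq hq]
    rw [hmap, hstrict.map_nhds_eq_of_equiv]
    exact le_rfl
  set e : OpenPartialHomeomorph (ℝ × E) (ℝ × E) :=
    OpenPartialHomeomorph.ofContinuousOpenRestrict e₀
      (htrack_cont.mono fun q hq => ⟨mem_univ _, hUW hq.2⟩) hopenmap hOopen with he
  have hecoe : ⇑e = slTrack P := rfl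
  have hesource : e.source = O := rfl
  have hesymm_smooth : ContDiffOn ℝ ∞ e.symm e.target := by
    intro b hb
    have hb' : e.symm b ∈ O := e.map_target hb
    obtain ⟨T, hT⟩ := hequiv _ (hOS hb')
    exact (e.contDiffAt_symm hb hT (htrack_at _ (hOS hb'))).contDiffWithinAt
  -- Step 5: the vector field on `Ω = e.target` and its cutoff
  set Ω : Set (ℝ × E) := e.target with hΩ
  have hΩopen : IsOpen Ω := e.open_target
  -- **`Ω` lies over `W'`**
  have hΩW' : ∀ b ∈ Ω, b.2 ∈ W' := fun b hb => by
    have hb' : e.symm b ∈ O := e.map_target hb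
    have hbe : b = slTrack P (e.symm b) := by rw [← hecoe]; exact (e.right_inv hb).symm
    rw [hbe]
    exact hOW' _ hb'
  set Y : ℝ × E → E := fun q => P (e.symm q).2 - (e.symm q).2 with hY
  have hYsmooth : ContDiffOn ℝ ∞ Y Ω := by
    have h2 : ContDiffOn ℝ ∞ (fun q => (e.symm q).2) Ω := hesymm_smooth.snd
    have hmaps : MapsTo (fun q => (e.symm q).2) Ω W := fun q hq => hUW (e.map_target hq).2
    exact (hP.comp h2 hmaps).sub h2
  -- a compact neighbourhood `Zc` of `Z` in `U` and the compact set `C'` of the track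
  obtain ⟨Zc, hZc, hZZc, hZcU⟩ := exists_compact_between hZ hUopen hZU
  set C' : Set (ℝ × E) := slTrack P '' (Icc (-(δ / 2)) (1 + δ / 2) ×ˢ Zc) with hC'
  have hIccJ : Icc (-(δ / 2)) (1 + δ / 2) ⊆ J := fun s hs =>
    ⟨by linarith [hs.1], by linarith [hs.2]⟩
  have hCO : Icc (-(δ / 2)) (1 + δ / 2) ×ˢ Zc ⊆ O := prod_mono hIccJ hZcU
  have hC'cpt : IsCompact C' := (isCompact_Icc.prod hZc).image_of_continuousOn
    ((htrack_cont.mono fun q hq => ⟨mem_univ _, hUW hq.2⟩).mono hCO)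
  have hC'Ω : C' ⊆ Ω := by
    rintro _ ⟨q, hq, rfl⟩
    exact e.map_source (show q ∈ e.source from hCO hq)
  obtain ⟨t₁, ht₁, hC't₁, ht₁Ω⟩ := exists_compact_between hC'cpt hΩopen hC'Ω
  obtain ⟨ρ, hρ1, hρ0, hρ01⟩ := exists_contMDiffMap_one_nhds_of_subset_interior 𝓘(ℝ, ℝ × E)
    hC'cpt.isClosed hC't₁ (n := (⊤ : ℕ∞))
  have hρsmooth : ContDiff ℝ ∞ (ρ : ℝ × E → ℝ) := contMDiff_iff_contDiff.1 ρ.contMDiff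
  set X : ℝ × E → E := fun q => (ρ q) • Y q with hX
  have hXsmooth : ContDiff ℝ ∞ X := by
    refine contDiff_iff_contDiffAt.2 fun q => ?_
    by_cases hq : q ∈ Ω
    · exact (hρsmooth.contDiffAt).smul (hYsmooth.contDiffAt (hΩopen.mem_nhds hq))
    · have hq' : q ∉ t₁ := fun h => hq (ht₁Ω h)
      have hev : X =ᶠ[𝓝 q] fun _ => 0 := by
        filter_upwards [ht₁.isClosed.isOpen_compl.mem_nhds hq'] with q' hq''
        simp only [hX, hρ0 q' hq'', zero_smul]
      exact contDiffAt_const.congr_of_eventuallyEq hev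
  have hXsupp : HasCompactSupport X := by
    refine HasCompactSupport.of_support_subset_isCompact ht₁ fun q hq => ?_
    by_contra hq'
    exact hq (by simp only [hX, hρ0 q hq', zero_smul])
  -- Step 6: the flow, as a diffeotopy
  have hn : (1 : ℕ∞) ≤ ⊤ := le_top
  set F : ℝ → E → E := fun s => Literature.Analysis.ODE.tdFlow hXsmooth hXsupp hn 0 s with hF
  set G : ℝ → E → E := fun s => Literature.Analysis.ODE.tdFlow hXsmooth hXsupp hn s 0 with hG
  have hflow := Literature.Analysis.ODE.contDiff_tdFlow hXsmooth hXsupp hn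
  have hFs : ContMDiff (𝓘(ℝ, ℝ).prod 𝓘(ℝ, E)) 𝓘(ℝ, E) ∞ (uncurry F) := by
    have h : ContDiff ℝ ∞ fun q : ℝ × E => ((0 : ℝ), q.1, q.2) :=
      contDiff_const.prodMk (contDiff_fst.prodMk contDiff_snd)
    exact contMDiff_prod_self_of_contDiff (hflow.comp h)
  have hGs : ContMDiff (𝓘(ℝ, ℝ).prod 𝓘(ℝ, E)) 𝓘(ℝ, E) ∞ (uncurry G) := by
    have h : ContDiff ℝ ∞ fun q : ℝ × E => (q.1, (0 : ℝ), q.2) :=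
      contDiff_fst.prodMk (contDiff_const.prodMk contDiff_snd)
    exact contMDiff_prod_self_of_contDiff (hflow.comp h)
  have hGF : ∀ s x, G s (F s x) = x := fun s x => by
    simp only [hF, hG]
    rw [Literature.Analysis.ODE.tdFlow_trans, Literature.Analysis.ODE.tdFlow_self]
  have hFG : ∀ s y, F s (G s y) = y := fun s y => by
    simp only [hF, hG]
    rw [Literature.Analysis.ODE.tdFlow_trans, Literature.Analysis.ODE.tdFlow_self]
  have hF0 : F 0 = id := by
    funext x
    simp only [hF, Literature.Analysis.ODE.tdFlow_self, id_eq]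
  set Φ := Diffeotopy.mk' 𝓘(ℝ, E) F G hFs hGs hGF hFG hF0 with hΦ
  have hΦF : Φ.toFun = F := Diffeotopy.mk'_toFun _ _ _ _ _ _ _
  have hΦG : Φ.invFun = G := Diffeotopy.mk'_invFun _ _ _ _ _ _ _
  -- the field vanishes at all times over `E ∖ W'`
  have hXoff : ∀ y, y ∉ W' → ∀ s : ℝ, X (s, y) = 0 := fun y hy s => by
    have hq' : ((s, y) : ℝ × E) ∉ t₁ := fun h => hy (hΩW' _ (ht₁Ω h))
    simp only [hX, hρ0 _ hq', zero_smul]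
  refine ⟨Φ, ?_, fun s y hy => ?_, fun s y hy => ?_, ?_⟩
  · -- agreement with `P` on `interior Zc` at time `1`
    have hagree : ∀ p ∈ interior Zc, Φ.toFun 1 p = P p := by
      intro p hp
      have hpZc : p ∈ Zc := interior_subset hp
      -- the straight line `s ↦ h_s p` is an integral curve of `X` on `(-δ/2, 1 + δ/2)`
      have hcurve : ∀ s ∈ Ioo (-(δ / 2)) (1 + δ / 2),
          HasDerivAt (fun s => slIsotopy P s p) (X (s, slIsotopy P s p)) s := by
        intro s hs
        have hsO : (s, p) ∈ O := hCO ⟨Ioo_subset_Icc_self hs, hpZc⟩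
        have hval : X (s, slIsotopy P s p) = P p - p := by
          have hmemC' : (s, slIsotopy P s p) ∈ C' :=
            ⟨(s, p), ⟨Ioo_subset_Icc_self hs, hpZc⟩, rfl⟩
          have hρq : ρ (s, slIsotopy P s p) = 1 := hρ1.self_of_nhdsSet _ hmemC'
          have hsymm : e.symm (s, slIsotopy P s p) = (s, p) := by
            have := e.left_inv (show (s, p) ∈ e.source from hsO)
            simpa [hecoe] using this
          simp only [hX, hY, hρq, one_smul, hsymm]
        rw [hval]
        have h1 : HasDerivAt (fun s : ℝ => s • (P p - p)) ((1 : ℝ) • (P p - p)) s :=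
          (hasDerivAt_id s).smul_const _
        rw [one_smul] at h1
        have h2 := h1.const_add p
        exact h2
      have key := Literature.Analysis.ODE.tdFlow_eq_of_hasDerivAt hXsmooth hXsupp hn
        (γ := fun s => slIsotopy P s p) (a := -(δ / 2)) (b := 1 + δ / 2) (t₀ := 0)
        ⟨by linarith, by linarith⟩ hcurve (t := 1) ⟨by linarith, by linarith⟩
      simp only [slIsotopy_zero, slIsotopy_one] at key
      rw [hΦF]
      exact key
    exact Filter.eventually_of_mem (isOpen_interior.mem_nhdsSet.2 hZZc) hagree
  · -- `Φ_s = id` off `W'`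
    rw [hΦF]
    exact Literature.Analysis.ODE.tdFlow_eq_self_of_forall_eq_zero hXsmooth hXsupp hn
      (hXoff y hy) 0 s
  · -- `Φ_s⁻¹ = id` off `W'`
    rw [hΦG]
    exact Literature.Analysis.ODE.tdFlow_eq_self_of_forall_eq_zero hXsmooth hXsupp hn
      (hXoff y hy) s 0
  · obtain ⟨R, hR⟩ :=
      Literature.Analysis.ODE.exists_forall_le_norm_tdFlow_eq_self hXsmooth hXsupp hn
    exact ⟨R, fun s y hy => by rw [hΦF]; exact hR y hy 0 s⟩

end Extension

end Literature.Topology.FourManifolds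

end
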